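import Summits.Ventures.PercRepro.G3Class

/-!
# The kernel chunks of the G₃ class sums, part A2 (p6, gen 6; split gen 7 for the gate's 600-s elaboration budget)

Sure-set groups `6`–`11` of the `G3ClassA` lineage: `iGroup_g` with contiguous segments of `subsetsS3`,
each theorem `classOK_g_j` a closed Boolean check of ≤ 2,200 values of `kA3` by `decide +kernel`, `mem_seg_g` (the segments
cover the sure sets, kernel) and the group dispatch `classOK_g`.  Statements, names and proofs are those of `G3ClassA`
(gen 6); only the file boundary changed.  Assembled in `G3ClassAll.lean`.
-/

-- the kernel chunks below are heavy; elaborate them one at a time (memory)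
set_option Elab.async false

namespace PercRepro

open Finset

/-- Sure-set group `6` (1 sets). -/
def iGroup6 : List (Finset (Fin 9)) :=
  [{6}]

/-- Kernel chunk `6.0`: every `U` in this segment of `subsetsS3` passes `classOKpair I U` for all `I` of group `6`. -/ theorem classOK_6_0 : iGroup6.all (fun I => ((subsetsS3.drop 0).take 190).all (classOKpair I)) = true := by
  decide +kernel

/-- Kernel chunk `6.1`: every `U` in this segment of `subsetsS3` passes `classOKpair I U` for all `I` of group `6`. -/ theorem classOK_6_1 : iGroup6.all (fun I => ((subsetsS3.drop 190).take 66).all (classOKpair I)) = true := by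
  decide +kernel

/-- Every `U ⊆ S3` lies in one of the segments of `subsetsS3` used by group `6` (kernel-checked). -/ theorem mem_seg_6 : ∀ U : Finset (Fin 9), U ⊆ S3 → U ∈ (subsetsS3.drop 0).take 190 ∨ U ∈ (subsetsS3.drop 190).take 66 := by
  decide +kernel

/-- Class-level check for group `6`: all `(I, U)` with `I` in the group and `U ⊆ S3` pass `classOKpair`. -/ theorem classOK_6 : ∀ I ∈ iGroup6, ∀ U : Finset (Fin 9), U ⊆ S3 → classOKpair I U = true := by
  intro I hI U hU
  rcases mem_seg_6 U hU with h0 | h1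
  · exact List.all_eq_true.mp (List.all_eq_true.mp classOK_6_0 I hI) U h0
  · exact List.all_eq_true.mp (List.all_eq_true.mp classOK_6_1 I hI) U h1

/-- Sure-set group `7` (1 sets). -/
def iGroup7 : List (Finset (Fin 9)) :=
  [{7}]

/-- Kernel chunk `7.0`: every `U` in this segment of `subsetsS3` passes `classOKpair I U` for all `I` of group `7`. -/ theorem classOK_7_0 : iGroup7.all (fun I => ((subsetsS3.drop 0).take 190).all (classOKpair I)) = true := by
  decide +kernel

/-- Kernel chunk `7.1`: every `U` in this segment of `subsetsS3` passes `classOKpair I U` for all `I` of group `7`. -/ theorem classOK_7_1 : iGroup7.all (fun I => ((subsetsS3.drop 190).take 66).all (classOKpair I)) = true := by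
  decide +kernel

/-- Every `U ⊆ S3` lies in one of the segments of `subsetsS3` used by group `7` (kernel-checked). -/ theorem mem_seg_7 : ∀ U : Finset (Fin 9), U ⊆ S3 → U ∈ (subsetsS3.drop 0).take 190 ∨ U ∈ (subsetsS3.drop 190).take 66 := by
  decide +kernel

/-- Class-level check for group `7`: all `(I, U)` with `I` in the group and `U ⊆ S3` pass `classOKpair`. -/ theorem classOK_7 : ∀ I ∈ iGroup7, ∀ U : Finset (Fin 9), U ⊆ S3 → classOKpair I U = true := by
  intro I hI U hU
  rcases mem_seg_7 U hU with h0 | h1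
  · exact List.all_eq_true.mp (List.all_eq_true.mp classOK_7_0 I hI) U h0
  · exact List.all_eq_true.mp (List.all_eq_true.mp classOK_7_1 I hI) U h1

/-- Sure-set group `8` (1 sets). -/
def iGroup8 : List (Finset (Fin 9)) :=
  [{8}]

/-- Kernel chunk `8.0`: every `U` in this segment of `subsetsS3` passes `classOKpair I U` for all `I` of group `8`. -/ theorem classOK_8_0 : iGroup8.all (fun I => ((subsetsS3.drop 0).take 190).all (classOKpair I)) = true := by
  decide +kernel

/-- Kernel chunk `8.1`: every `U` in this segment of `subsetsS3` passes `classOKpair I U` for all `I` of group `8`. -/ theorem classOK_8_1 : iGroup8.all (fun I => ((subsetsS3.drop 190).take 66).all (classOKpair I)) = true := by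
  decide +kernel

/-- Every `U ⊆ S3` lies in one of the segments of `subsetsS3` used by group `8` (kernel-checked). -/ theorem mem_seg_8 : ∀ U : Finset (Fin 9), U ⊆ S3 → U ∈ (subsetsS3.drop 0).take 190 ∨ U ∈ (subsetsS3.drop 190).take 66 := by
  decide +kernel

/-- Class-level check for group `8`: all `(I, U)` with `I` in the group and `U ⊆ S3` pass `classOKpair`. -/ theorem classOK_8 : ∀ I ∈ iGroup8, ∀ U : Finset (Fin 9), U ⊆ S3 → classOKpair I U = true := by
  intro I hI U hU
  rcases mem_seg_8 U hU with h0 | h1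
  · exact List.all_eq_true.mp (List.all_eq_true.mp classOK_8_0 I hI) U h0
  · exact List.all_eq_true.mp (List.all_eq_true.mp classOK_8_1 I hI) U h1

/-- Sure-set group `9` (3 sets). -/
def iGroup9 : List (Finset (Fin 9)) :=
  [{0, 1}, {0, 2}, {0, 4}]

/-- Kernel chunk `9.0`: every `U` in this segment of `subsetsS3` passes `classOKpair I U` for all `I` of group `9`. -/ theorem classOK_9_0 : iGroup9.all (fun I => ((subsetsS3.drop 0).take 101).all (classOKpair I)) = true := by
  decide +kernel

/-- Kernel chunk `9.1`: every `U` in this segment of `subsetsS3` passes `classOKpair I U` for all `I` of group `9`. -/ theorem classOK_9_1 : iGroup9.all (fun I => ((subsetsS3.drop 101).take 155).all (classOKpair I)) = true := by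
  decide +kernel

/-- Every `U ⊆ S3` lies in one of the segments of `subsetsS3` used by group `9` (kernel-checked). -/ theorem mem_seg_9 : ∀ U : Finset (Fin 9), U ⊆ S3 → U ∈ (subsetsS3.drop 0).take 101 ∨ U ∈ (subsetsS3.drop 101).take 155 := by
  decide +kernel

/-- Class-level check for group `9`: all `(I, U)` with `I` in the group and `U ⊆ S3` pass `classOKpair`. -/ theorem classOK_9 : ∀ I ∈ iGroup9, ∀ U : Finset (Fin 9), U ⊆ S3 → classOKpair I U = true := by
  intro I hI U hU
  rcases mem_seg_9 U hU with h0 | h1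
  · exact List.all_eq_true.mp (List.all_eq_true.mp classOK_9_0 I hI) U h0
  · exact List.all_eq_true.mp (List.all_eq_true.mp classOK_9_1 I hI) U h1

/-- Sure-set group `10` (3 sets). -/
def iGroup10 : List (Finset (Fin 9)) :=
  [{0, 5}, {0, 6}, {0, 7}]

/-- Kernel chunk `10.0`: every `U` in this segment of `subsetsS3` passes `classOKpair I U` for all `I` of group `10`. -/ theorem classOK_10_0 : iGroup10.all (fun I => ((subsetsS3.drop 0).take 106).all (classOKpair I)) = true := by
  decide +kernel

/-- Kernel chunk `10.1`: every `U` in this segment of `subsetsS3` passes `classOKpair I U` for all `I` of group `10`. -/ theorem classOK_10_1 : iGroup10.all (fun I => ((subsetsS3.drop 106).take 150).all (classOKpair I)) = true := by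
  decide +kernel

/-- Every `U ⊆ S3` lies in one of the segments of `subsetsS3` used by group `10` (kernel-checked). -/ theorem mem_seg_10 : ∀ U : Finset (Fin 9), U ⊆ S3 → U ∈ (subsetsS3.drop 0).take 106 ∨ U ∈ (subsetsS3.drop 106).take 150 := by
  decide +kernel

/-- Class-level check for group `10`: all `(I, U)` with `I` in the group and `U ⊆ S3` pass `classOKpair`. -/ theorem classOK_10 : ∀ I ∈ iGroup10, ∀ U : Finset (Fin 9), U ⊆ S3 → classOKpair I U = true := by
  intro I hI U hU
  rcases mem_seg_10 U hU with h0 | h1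
  · exact List.all_eq_true.mp (List.all_eq_true.mp classOK_10_0 I hI) U h0
  · exact List.all_eq_true.mp (List.all_eq_true.mp classOK_10_1 I hI) U h1

/-- Sure-set group `11` (3 sets). -/
def iGroup11 : List (Finset (Fin 9)) :=
  [{0, 8}, {1, 2}, {1, 4}]

/-- Kernel chunk `11.0`: every `U` in this segment of `subsetsS3` passes `classOKpair I U` for all `I` of group `11`. -/ theorem classOK_11_0 : iGroup11.all (fun I => ((subsetsS3.drop 0).take 106).all (classOKpair I)) = true := by
  decide +kernel

/-- Kernel chunk `11.1`: every `U` in this segment of `subsetsS3` passes `classOKpair I U` for all `I` of group `11`. -/ theorem classOK_11_1 : iGroup11.all (fun I => ((subsetsS3.drop 106).take 150).all (classOKpair I)) = true := by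
  decide +kernel

/-- Every `U ⊆ S3` lies in one of the segments of `subsetsS3` used by group `11` (kernel-checked). -/ theorem mem_seg_11 : ∀ U : Finset (Fin 9), U ⊆ S3 → U ∈ (subsetsS3.drop 0).take 106 ∨ U ∈ (subsetsS3.drop 106).take 150 := by
  decide +kernel

/-- Class-level check for group `11`: all `(I, U)` with `I` in the group and `U ⊆ S3` pass `classOKpair`. -/ theorem classOK_11 : ∀ I ∈ iGroup11, ∀ U : Finset (Fin 9), U ⊆ S3 → classOKpair I U = true := by
  intro I hI U hU
  rcases mem_seg_11 U hU with h0 | h1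
  · exact List.all_eq_true.mp (List.all_eq_true.mp classOK_11_0 I hI) U h0
  · exact List.all_eq_true.mp (List.all_eq_true.mp classOK_11_1 I hI) U h1

end PercRepro
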